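import Summits.NavierStokesRegularity.FluidComputer.DesignedBlowupClayBridge
import HarnessLib

/-!
# The residual door (β′) of the E–C endpoint, by name: a designed pair is forced Navier–Stokes
# with EXACTLY ONE force — its own residual — and (C) follows as soon as that residual is the
# restriction of a Clay-class field

Cell `ns-blowup`, seat `ns-blowup-ecbridge-2` (g4; the E–C endpoint theory seat). LABEL: E–C typing
(KERNEL; one definition `nsResidual`, one named shape `ClayResidualDesign`). WHAT THIS IS NOT: not
Navier–Stokes evidence — nothing is constructed and no inhabitant of any type below is asserted; the
theorems say what would have to be FOUND. Companion memos:
`run/shared/lean/pub/ns-blowup/ecbridge2/ECBRIDGE-2-MEMO-2.md` §1 (the door (β′)) and `…-MEMO-3.md`.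

## Why this file (purpose line of the seat: «force C^∞ THROUGH T*: if found, a typed lemma»)

The seat's answer of record (MEMO-1 §3, MEMO-2 §1/§4): in the a-posteriori style (β) one DESIGNS a
velocity–pressure pair `(U, P)` on `[0, T) × ℝ³` and DECLARES the force to be its Navier–Stokes
residual `g := ∂ₜU + (U·∇)U − νΔU + ∇P`. Then `(U, P)` is an exact classical solution of the system
forced by `g` — trivially, and for NO other force — so «the E–C force is `C^∞` through `T*`» says
exactly that the residual of the design is the restriction to `[0, T)` of a Clay-class field on
`[0, ∞) × ℝ³` (smooth on the CLOSED half-space, Fefferman's decay (5)); at a singular point this is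
an infinite-order cancellation (door (β′), «the flat residual of an all-orders formal blow-up»). This
file types that sentence:

* `nsResidual S ν U P` — the residual, with the tree's one-sided time derivative `timeDerivWithin S`;
* `isClassicalNSSolutionOn_nsResidual` — **every jointly smooth divergence-free pair is an exact
  classical solution of Navier–Stokes forced by its own residual** (any viscosity, any time set);
  `IsClassicalNSSolutionOn.force_eq_nsResidual` — and by no other force;
  `isClassicalNSSolutionOn_iff_nsResidual` — the dichotomy (α)/(β) of MEMO-1 §1 as an `↔`;
* `isSmoothSpaceTimeOn_nsResidual` — the residual is jointly smooth ON `S` (before `T`): smoothness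
  THROUGH `T` is the whole content, and it is NOT a consequence of anything here;
* `ClayResidualDesign ν` — the door (β′) as ONE proposition (a smooth divergence-free design on
  `[0, T)` with Clay datum, finite energy and slab bounds, maximal at `T`, whose residual is the
  restriction of a Clay-class field) and **`nonempty_designedBlowup_iff : Nonempty (DesignedBlowup ν)
  ↔ ClayResidualDesign ν`** — the generic E–C object of record IS a Clay-residual design, literally;
* `DesignedBlowup.ofResidual` (compact pointwise blow-up witness ⇒ maximal, via `ofUnboundedOn`) and
  **`navierStokesBreakdownR3_of_clayResidual`**: Fefferman's (C) from ONE smooth divergence-free pair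
  at ONE viscosity `μ > 0`, blowing up on a compact set at `T`, whose residual extends to a Clay
  force — NO stability theorem, NO named fact (the closer `navierStokesBreakdownR3_of_designedBlowup`
  does the rest: forced weak–strong uniqueness of PATH B′ and the viscosity rescaling).

So the «typed lemma if found» of the purpose line is `navierStokesBreakdownR3_of_clayResidual`; what
has to be found is an inhabitant of its hypotheses, and the seat's memos record that none is in
print or in the cell (MEMO-2 §1: every printed forced blow-up is a FINITE-order design with a rough
force; §3: the order ladder in the Euler window; T22/T23/EXACT-ANSATZ are the typed kills).

References: C. L. Fefferman, Clay problem description, (C) with (4)–(7) [cite: FeffermanClay2006, (C)];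
J. T. Beale, T. Kato, A. Majda, Comm. Math. Phys. 94 (1984) §1 (classical solutions, continuation)
[cite: BealeKatoMajda1984, §1]; T. Tao, Anal. PDE 6 (2013) = arXiv:1108.1165, (3)–(6)
[cite: Tao2011, (3)–(6)].
-/

noncomputable section

namespace Summit.NavierStokesRegularity.FluidComputer

open Set MeasureTheory Filter Topology Function
open scoped ENNReal NNReal ContDiff Laplacian
open Literature.Analysis.FluidPDE

/-! ## §1 The Navier–Stokes residual of a designed pair -/

section Residual

variable {E : Type*} [NormedAddCommGroup E] [InnerProductSpace ℝ E] [FiniteDimensional ℝ E]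

/-- **The Navier–Stokes residual** of a velocity–pressure pair `(U, P)` at viscosity `ν` on the time
set `S`: `nsResidual S ν U P (t, x) = ∂ₜU + (U·∇)U − νΔU + ∇P`, with the one-sided time derivative
`timeDerivWithin S` of the tree's `IsClassicalNSSolutionOn` (so that the momentum equation
`∂ₜU + (U·∇)U = νΔU − ∇P + f` reads `f = nsResidual S ν U P` on `S`). In the a-posteriori style (β)
of an E–C claim this IS the force. [cite: Tao2011, (3)] -/
def nsResidual (S : Set ℝ) (ν : ℝ) (U : ℝ → E → E) (P : ℝ → E → ℝ) (t : ℝ) (x : E) : E :=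
  timeDerivWithin S U t x + convect (U t) (U t) x - ν • (Δ (U t)) x + gradient (P t) x

variable {S : Set ℝ} {ν : ℝ} {U f : ℝ → E → E} {P : ℝ → E → ℝ}

/-- Unfolding the residual. [folklore] -/
theorem nsResidual_apply (S : Set ℝ) (ν : ℝ) (U : ℝ → E → E) (P : ℝ → E → ℝ) (t : ℝ) (x : E) :
    nsResidual S ν U P t x =
      timeDerivWithin S U t x + convect (U t) (U t) x - ν • (Δ (U t)) x + gradient (P t) x :=
  rfl

/-- **Every jointly smooth divergence-free pair is an exact classical solution of the Navier–Stokes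
system forced by its own residual** — at any viscosity, on any time set. (The momentum equation with
`f := nsResidual S ν U P` is an identity.) This is the whole of style (β): designing `(U, P)` never
lowers the burden, it only renames the residual «force». [cite: BealeKatoMajda1984, §1] -/
theorem isClassicalNSSolutionOn_nsResidual (hU : IsSmoothSpaceTimeOn S U) (hP : IsSmoothSpaceTimeOn S P)
    (hdiv : ∀ t ∈ S, VectorCalculus.IsDivFree (U t)) :
    IsClassicalNSSolutionOn S ν (nsResidual S ν U P) U P where
  smooth_velocity := hU
  smooth_pressure := hP
  momentum t _ x := by rw [nsResidual_apply]; abel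
  divFree := hdiv

/-- A smooth divergence-free pair solves the system forced by ANY field that agrees with its
residual on `S`. [cite: BealeKatoMajda1984, §1] -/
theorem isClassicalNSSolutionOn_of_eq_nsResidual (hU : IsSmoothSpaceTimeOn S U)
    (hP : IsSmoothSpaceTimeOn S P) (hdiv : ∀ t ∈ S, VectorCalculus.IsDivFree (U t))
    (hf : ∀ t ∈ S, ∀ x, f t x = nsResidual S ν U P t x) : IsClassicalNSSolutionOn S ν f U P where
  smooth_velocity := hU
  smooth_pressure := hP
  momentum t ht x := by rw [hf t ht x, nsResidual_apply]; abel
  divFree := hdiv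

/-- **… and by no other force**: the force of a classical solution IS the residual of its
velocity–pressure pair on `S` (the momentum equation determines `f`). [cite: Tao2011, (3)] -/
theorem _root_.Literature.Analysis.FluidPDE.IsClassicalNSSolutionOn.force_eq_nsResidual
    (h : IsClassicalNSSolutionOn S ν f U P) : ∀ t ∈ S, ∀ x, f t x = nsResidual S ν U P t x := by
  intro t ht x
  have hm := h.momentum t ht x
  rw [nsResidual_apply]
  rw [← sub_eq_zero] at hm ⊢
  rw [← neg_eq_zero, ← hm]
  abel

/-- **The dichotomy of MEMO-1 §1 as an equivalence**: `(U, P)` is a classical solution forced by `f`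
on `S` iff `U`, `P` are jointly smooth on `S`, `U` is divergence free, and `f` is the residual of
`(U, P)` on `S`. In style (α) the force is given and the content is the (unknown) true solution; in
style (β) the pair is given and the force is whatever this says. [cite: BealeKatoMajda1984, §1] -/
theorem isClassicalNSSolutionOn_iff_nsResidual :
    IsClassicalNSSolutionOn S ν f U P ↔
      IsSmoothSpaceTimeOn S U ∧ IsSmoothSpaceTimeOn S P ∧ (∀ t ∈ S, VectorCalculus.IsDivFree (U t)) ∧
        ∀ t ∈ S, ∀ x, f t x = nsResidual S ν U P t x :=
  ⟨fun h => ⟨h.smooth_velocity, h.smooth_pressure, h.divFree, h.force_eq_nsResidual⟩,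
    fun h => isClassicalNSSolutionOn_of_eq_nsResidual h.1 h.2.1 h.2.2.1 h.2.2.2⟩

/-- **The residual is jointly smooth ON `S`** (a time set of unique differentiability, e.g. `[0, T)`):
as smooth as the pair, BEFORE the end of `S`. Nothing here says anything about smoothness THROUGH the
end of `S` — that is the entire content of an E–C claim in style (β). [folklore] -/
theorem isSmoothSpaceTimeOn_nsResidual (hU : IsSmoothSpaceTimeOn S U) (hP : IsSmoothSpaceTimeOn S P)
    (hS : UniqueDiffOn ℝ S) : IsSmoothSpaceTimeOn S (nsResidual S ν U P) :=
  (((hU.timeDerivWithin hS).add (hU.convect hU hS)).sub ((hU.laplacian hS).const_smul ν)).add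
    (hP.gradient hS)

/-- On a smaller time set of unique differentiability the residual of a pair smooth on `S` is
unchanged (the one-sided time derivative is; `IsSmoothSpaceTimeOn.timeDerivWithin_eq_of_subset`).
[folklore] -/
theorem nsResidual_eq_of_subset {S' : Set ℝ} (hU : IsSmoothSpaceTimeOn S U) (hS' : S' ⊆ S)
    (hS'u : UniqueDiffOn ℝ S') {t : ℝ} (ht : t ∈ S') (x : E) :
    nsResidual S' ν U P t x = nsResidual S ν U P t x := by
  simp only [nsResidual_apply, hU.timeDerivWithin_eq_of_subset hS' hS'u ht x]

end Residual

/-! ## §2 The door (β′) as one proposition, and the generic E–C object read through it -/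

/-- **A Clay-residual design at viscosity `ν`** (the door (β′) of the E–C endpoint, MEMO-2 §1, as ONE
proposition): a blow-up time `T > 0`, a velocity–pressure pair `(U, P)` jointly smooth on
`[0, T) × ℝ³` with `U` divergence free, a field `F` on `[0, ∞) × ℝ³` of CLAY CLASS — smooth on the
closed half-space, THROUGH `T`, with Fefferman's decay (5) — which agrees with the Navier–Stokes
residual of `(U, P)` on `[0, T)`, NO classical extension of `U` past `T` under the force `F`, Clay
datum `U 0`, finite energy and a velocity bound on every closed sub-slab `[0, T']`, `T' < T`. A
PROPOSITION (conjecture-grade: it implies (C), `navierStokesBreakdownR3_of_clayResidualDesign`);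
asserted nowhere. [cite: FeffermanClay2006, (C) (4) (5) (6)] -/
@[conjecture] def ClayResidualDesign (ν : ℝ) : Prop :=
  ∃ (T : ℝ) (_ : 0 < T) (U : ℝ → EuclideanSpace ℝ (Fin 3) → EuclideanSpace ℝ (Fin 3))
    (P : ℝ → EuclideanSpace ℝ (Fin 3) → ℝ)
    (F : ℝ → EuclideanSpace ℝ (Fin 3) → EuclideanSpace ℝ (Fin 3)),
    IsSmoothSpaceTimeOn (Ico 0 T) U ∧ IsSmoothSpaceTimeOn (Ico 0 T) P ∧
      (∀ t ∈ Ico 0 T, VectorCalculus.IsDivFree (U t)) ∧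
      IsSmoothOnHalfSpace F ∧ HasRapidSpaceTimeDecay F ∧
      (∀ t ∈ Ico 0 T, ∀ x, F t x = nsResidual (Ico 0 T) ν U P t x) ∧
      ¬ HasSmoothExtensionPast ν F U T ∧
      HasRapidSpatialDecay (U 0) ∧
      (∀ T', T' < T → ∃ C : ℝ≥0∞, C < ⊤ ∧ ∀ t ∈ Icc 0 T', ∫⁻ x, ‖U t x‖ₑ ^ 2 ≤ C) ∧
      (∀ T', T' < T → ∃ B : ℝ, ∀ t ∈ Icc 0 T', ∀ x, ‖U t x‖ ≤ B)

namespace DesignedBlowup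

variable {ν : ℝ}

/-- **The force of a designed blow-up IS the residual of its designed pair on `[0, T)`.**
[cite: Tao2011, (3)] -/
theorem force_eq_nsResidual (D : DesignedBlowup ν) :
    ∀ t ∈ Ico 0 D.T, ∀ x, D.f t x = nsResidual (Ico 0 D.T) ν D.u D.p t x :=
  D.classical.force_eq_nsResidual

/-- **Constructor: a designed blow-up from a designed pair whose residual extends to a Clay force,
maximal at `T`.** The `classical` field of `DesignedBlowup` is supplied by
`isClassicalNSSolutionOn_of_eq_nsResidual`. [cite: FeffermanClay2006, (C)] -/
def ofResidualMaximal (T : ℝ) (T_pos : 0 < T)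
    (U : ℝ → EuclideanSpace ℝ (Fin 3) → EuclideanSpace ℝ (Fin 3))
    (P : ℝ → EuclideanSpace ℝ (Fin 3) → ℝ)
    (F : ℝ → EuclideanSpace ℝ (Fin 3) → EuclideanSpace ℝ (Fin 3))
    (hU : IsSmoothSpaceTimeOn (Ico 0 T) U) (hP : IsSmoothSpaceTimeOn (Ico 0 T) P)
    (hdiv : ∀ t ∈ Ico 0 T, VectorCalculus.IsDivFree (U t))
    (force_smooth : IsSmoothOnHalfSpace F) (force_decay : HasRapidSpaceTimeDecay F)
    (hres : ∀ t ∈ Ico 0 T, ∀ x, F t x = nsResidual (Ico 0 T) ν U P t x)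
    (no_extension : ¬ HasSmoothExtensionPast ν F U T)
    (datum_decay : HasRapidSpatialDecay (U 0))
    (energy : ∀ T', T' < T → ∃ C : ℝ≥0∞, C < ⊤ ∧ ∀ t ∈ Icc 0 T', ∫⁻ x, ‖U t x‖ₑ ^ 2 ≤ C)
    (bounded : ∀ T', T' < T → ∃ B : ℝ, ∀ t ∈ Icc 0 T', ∀ x, ‖U t x‖ ≤ B) : DesignedBlowup ν where
  T := T
  T_pos := T_pos
  u := U
  p := P
  f := F
  classical := isClassicalNSSolutionOn_of_eq_nsResidual hU hP hdiv hres
  no_extension := no_extension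
  datum_decay := datum_decay
  force_smooth := force_smooth
  force_decay := force_decay
  energy := energy
  bounded := bounded

/-- **Constructor: a designed blow-up from a designed pair whose residual extends to a Clay force,
with a POINTWISE blow-up witness** (`U` unbounded on `[0, T) × K`, `K` compact — the shape every
construction produces; maximality by `not_hasSmoothExtensionPast_of_unboundedOn`).
[cite: FeffermanClay2006, (C)] -/
def ofResidual (T : ℝ) (T_pos : 0 < T)
    (U : ℝ → EuclideanSpace ℝ (Fin 3) → EuclideanSpace ℝ (Fin 3))
    (P : ℝ → EuclideanSpace ℝ (Fin 3) → ℝ)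
    (F : ℝ → EuclideanSpace ℝ (Fin 3) → EuclideanSpace ℝ (Fin 3))
    (hU : IsSmoothSpaceTimeOn (Ico 0 T) U) (hP : IsSmoothSpaceTimeOn (Ico 0 T) P)
    (hdiv : ∀ t ∈ Ico 0 T, VectorCalculus.IsDivFree (U t))
    (force_smooth : IsSmoothOnHalfSpace F) (force_decay : HasRapidSpaceTimeDecay F)
    (hres : ∀ t ∈ Ico 0 T, ∀ x, F t x = nsResidual (Ico 0 T) ν U P t x)
    (K : Set (EuclideanSpace ℝ (Fin 3))) (hK : IsCompact K)
    (unbounded : ∀ M : ℝ, ∃ t ∈ Ico 0 T, ∃ x ∈ K, M < ‖U t x‖)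
    (datum_decay : HasRapidSpatialDecay (U 0))
    (energy : ∀ T', T' < T → ∃ C : ℝ≥0∞, C < ⊤ ∧ ∀ t ∈ Icc 0 T', ∫⁻ x, ‖U t x‖ₑ ^ 2 ≤ C)
    (bounded : ∀ T', T' < T → ∃ B : ℝ, ∀ t ∈ Icc 0 T', ∀ x, ‖U t x‖ ≤ B) : DesignedBlowup ν :=
  ofResidualMaximal T T_pos U P F hU hP hdiv force_smooth force_decay hres
    (not_hasSmoothExtensionPast_of_unboundedOn hK unbounded) datum_decay energy bounded

/-- **The generic E–C object of record IS a Clay-residual design, literally**: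
`Nonempty (DesignedBlowup ν) ↔ ClayResidualDesign ν`. (→: the force of a designed blow-up is the
residual of its pair, `force_eq_nsResidual`; ←: `ofResidualMaximal`.) So «can the E–C force be `C^∞`
THROUGH `T*`» and «is there a smooth divergence-free design whose Navier–Stokes residual is flat
enough at the singularity to extend as a Clay field» are the same question.
[cite: FeffermanClay2006, (C)] -/
theorem nonempty_iff_clayResidualDesign : Nonempty (DesignedBlowup ν) ↔ ClayResidualDesign ν := by
  constructor
  · rintro ⟨D⟩
    exact ⟨D.T, D.T_pos, D.u, D.p, D.f, D.classical.smooth_velocity, D.classical.smooth_pressure,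
      D.classical.divFree, D.force_smooth, D.force_decay, D.force_eq_nsResidual, D.no_extension,
      D.datum_decay, D.energy, D.bounded⟩
  · rintro ⟨T, hT, U, P, F, hU, hP, hdiv, hFs, hFd, hres, hmax, hdat, hen, hbd⟩
    exact ⟨ofResidualMaximal T hT U P F hU hP hdiv hFs hFd hres hmax hdat hen hbd⟩

end DesignedBlowup

/-! ## §3 Fefferman's (C) from a Clay-residual design — the «typed lemma if found» -/

/-- **(C) from ONE Clay-residual design at ONE viscosity.** If, for some `μ > 0`, there are a time
`T > 0`, a pair `(U, P)` jointly smooth on `[0, T) × ℝ³` with `U` divergence free, Clay datum `U 0`,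
finite energy and a velocity bound on every closed sub-slab, `U` UNBOUNDED on `[0, T) × K` for a
compact `K`, and a Clay-class field `F` on `[0, ∞) × ℝ³` (smooth through `T`, decay (5)) which
agrees on `[0, T)` with the Navier–Stokes residual `∂ₜU + (U·∇)U − μΔU + ∇P` — then Fefferman's (C)
holds (at every viscosity). NO stability theorem and NO named fact: the pair is an exact solution of
the system forced by `F` (`isClassicalNSSolutionOn_of_eq_nsResidual`), maximal by compactness, and
the generic closer `navierStokesBreakdownR3_of_designedBlowup` (forced weak–strong uniqueness of
PATH B′ + viscosity rescaling) does the rest. This is the door (β′) of MEMO-2 §1 by name; no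
inhabitant of its hypotheses is known (MEMO-2 §1, §3). [cite: FeffermanClay2006, (C)] -/
theorem navierStokesBreakdownR3_of_clayResidual {μ : ℝ} (hμ : 0 < μ) {T : ℝ} (hT : 0 < T)
    {U : ℝ → EuclideanSpace ℝ (Fin 3) → EuclideanSpace ℝ (Fin 3)}
    {P : ℝ → EuclideanSpace ℝ (Fin 3) → ℝ}
    {F : ℝ → EuclideanSpace ℝ (Fin 3) → EuclideanSpace ℝ (Fin 3)}
    (hU : IsSmoothSpaceTimeOn (Ico 0 T) U) (hP : IsSmoothSpaceTimeOn (Ico 0 T) P)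
    (hdiv : ∀ t ∈ Ico 0 T, VectorCalculus.IsDivFree (U t))
    (hFs : IsSmoothOnHalfSpace F) (hFd : HasRapidSpaceTimeDecay F)
    (hres : ∀ t ∈ Ico 0 T, ∀ x, F t x = nsResidual (Ico 0 T) μ U P t x)
    {K : Set (EuclideanSpace ℝ (Fin 3))} (hK : IsCompact K)
    (unbounded : ∀ M : ℝ, ∃ t ∈ Ico 0 T, ∃ x ∈ K, M < ‖U t x‖)
    (datum_decay : HasRapidSpatialDecay (U 0))
    (energy : ∀ T', T' < T → ∃ C : ℝ≥0∞, C < ⊤ ∧ ∀ t ∈ Icc 0 T', ∫⁻ x, ‖U t x‖ₑ ^ 2 ≤ C)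
    (bounded : ∀ T', T' < T → ∃ B : ℝ, ∀ t ∈ Icc 0 T', ∀ x, ‖U t x‖ ≤ B) :
    Summit.NavierStokesRegularity.NavierStokesRegularity.NavierStokesBreakdownR3 :=
  navierStokesBreakdownR3_of_designedBlowup hμ
    (DesignedBlowup.ofResidual T hT U P F hU hP hdiv hFs hFd hres K hK unbounded datum_decay energy
      bounded)

/-- **(C) from a Clay-residual design (the proposition form)**: `ClayResidualDesign μ → (C)` for any
single `μ > 0`. [cite: FeffermanClay2006, (C)] -/
theorem navierStokesBreakdownR3_of_clayResidualDesign {μ : ℝ} (hμ : 0 < μ)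
    (h : ClayResidualDesign μ) :
    Summit.NavierStokesRegularity.NavierStokesRegularity.NavierStokesBreakdownR3 := by
  obtain ⟨D⟩ := DesignedBlowup.nonempty_iff_clayResidualDesign.2 h
  exact navierStokesBreakdownR3_of_designedBlowup hμ D

end Summit.NavierStokesRegularity.FluidComputer

end
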